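import Literature.AlgebraicGeometry.ShimuraVarieties.KudlaRapoport2013.Sec7to10EisensteinSide
import Literature.NumberTheory.QuadraticFields.HeegnerCondition
import Mathlib.NumberTheory.NumberField.Discriminant.Different
import Mathlib.NumberTheory.RamificationInertia.Galois
import Mathlib.NumberTheory.RamificationInertia.Unramified
import Mathlib.NumberTheory.Padics.Hensel
import Mathlib.FieldTheory.Galois.IsGaloisGroup
import HarnessLib

/-!
# [KudlaRapoport2013, §9 after (9.2) (arXiv v2 p. 33)] «only ramified or inert primes can occur in `Diff(T, V)`» —
# DISCHARGED: `KR2013_9_diff_subset_holds`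

Kernel-lane companion of the statement carpet ★
`Literature/AlgebraicGeometry/ShimuraVarieties/KudlaRapoport2013/Sec7to10EisensteinSide.lean`: its CLOSED named fact ★
`KR2013_9_diff_subset` — S. Kudla, M. Rapoport, *Special cycles on unitary Shimura varieties II: global theory*, J. reine angew.
Math. 697 (2014), §9, the sentence after (9.2) (arXiv:0912.3758v2 p. 33): «`Diff(T, V) = {p < ∞ ∣ χ_p(det T) = −χ_p(det V)}` (9.2).
Note that only ramified or inert primes can occur in this set.» — typed: for hermitian `T`, `J` with nonzero determinants every
`p ∈ diff k T J` is ★ `IsRamifiedPrime k p` or ★ `IsInertPrime k p` — is PROVED here.  THEOREMS ONLY (no definition, no named fact,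
no `sorry`, no instance, no notation); cell hodgecm-mathlib, seat B-typ04 (g31); net debt −1.

## The proof

At a SPLIT prime `p` (`p ∤ d_k` and `p O_k` not a prime ideal) every rational number is a local norm from `k ⊗ ℚ_p ≅ ℚ_p × ℚ_p`
(`isLocalNormAt_of_split`), so `χ_p(det T) = χ_p(det V) = 1` and `p ∉ Diff(T, V)`:
* `ncard_primesOver_eq_two`: `p ∤ d_k` makes every prime over `p` unramified (Mathlib `NumberField.not_dvd_discr_iff_forall_liesOver`,
  `Ideal.ramificationIdx_eq_one_of_isUnramifiedAt`), and `e f g = 2` (`Ideal.ncard_primesOver_mul_ramificationIdxIn_mul_inertiaDegIn`)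
  with `g = 1` would give `p O_k = 𝔭` prime (`Ideal.map_algebraMap_eq_finsetProd_pow`); hence `g = 2`;
* `exists_padicInt_sq_eq`: then `d_k ≡ β² (mod 4p)` (tree ★ `Quadratic.exists_dvd_sq_sub_discr_of_ncard_primesOver`), `β` is a
  `p`-adic unit, and Hensel's lemma (Mathlib `hensels_lemma`, `‖β² − d_k‖ ≤ |4p|_p < |4|_p = ‖2β‖²`) gives `δ ∈ ℤ_p`, `δ² = d_k`;
* `isLocalNormAt_of_sq_eq`: with `θ = 2ω − t ∈ k`, `θ² = d_k`, `σ(θ) = −θ` (integral basis `(1, ω)`, `ω² = m + tω`; `σ(ω) = t − ω`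
  since `σ ≠ 1`), the element `z = (a+1)/2 ⊗ 1 + (a−1)/(2δ) ⊗ θ ∈ ℚ_p ⊗ k` has `z · (1 ⊗ σ)(z) = ((a+1)/2)² − d_k ((a−1)/(2δ))² = a`.
The determinants of the hermitian `T`, `J` are fixed by `σ` (`σ(det T) = det ᵗT`), hence rational by `2x = Tr(x)` on `σ`-fixed `x`
(`Gal(k/ℚ) = {1, σ}`), so the quantifiers of ★ `diff` bind them and `p ∈ Diff` contradicts the above.

## References
* [KudlaRapoport2013] S. Kudla, M. Rapoport, *Special cycles on unitary Shimura varieties II: global theory*, J. reine angew.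
  Math. 697 (2014) 91–157; arXiv:0912.3758v2, §9 (9.2) (p. 33).
* [Marcus2018] D. A. Marcus, *Number Fields*, 2nd ed., Springer 2018, Ch. 3, Thm. 25 (decomposition of primes in quadratic fields).
-/

set_option autoImplicit false

noncomputable section

open NumberField IsDedekindDomain Module Polynomial
open Literature.NumberTheory.Automorphic.Liu2021.AppendixC (conj conj_ne_one)
open Literature.AlgebraicGeometry.ShimuraVarieties.KudlaRapoport2013.Sec2Defs (IsInertPrime IsRamifiedPrime)
open Literature.AlgebraicGeometry.ShimuraVarieties.KudlaRapoport2013.Sec3ComplexUniformization (IsHermitianFor)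
open Literature.NumberTheory.QuadraticFields.Quadratic (exists_basis_zero_eq_one basis_one_mul_self_eq
  discr_eq_sq_add_four_mul exists_dvd_sq_sub_discr_of_ncard_primesOver)
open scoped TensorProduct Pointwise

namespace Literature.AlgebraicGeometry.ShimuraVarieties.KudlaRapoport2013.Sec7to10EisensteinSide

variable (k : Type) [Field k] [NumberField k] [IsTotallyComplex k] [Algebra.IsQuadraticExtension ℚ k]

/-! ### `Gal(k/ℚ) = {1, σ}` and its consequences -/

/-- In a group of order `2` with a non-trivial element `τ`, every element is `1` or `τ`. [folklore] -/
private theorem eq_one_or_eq_of_card_two {G : Type*} [Group G] (hG : Nat.card G = 2) {τ : G}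
    (hτ : τ ≠ 1) (σ : G) : σ = 1 ∨ σ = τ := by
  haveI : Finite G := Nat.finite_of_card_ne_zero (by rw [hG]; norm_num)
  have hsub : ({1, τ} : Set G) = Set.univ := by
    apply Set.eq_of_subset_of_ncard_le (Set.subset_univ _)
    rw [Set.ncard_univ, hG, Set.ncard_pair hτ.symm]
  have : σ ∈ ({1, τ} : Set G) := by rw [hsub]; exact Set.mem_univ σ
  simpa using this

/-- `Aut(k/ℚ) = {1, σ}`: sums over the automorphism group. [folklore] -/
private theorem sum_aut_eq {M : Type*} [AddCommMonoid M] (f : (k ≃ₐ[ℚ] k) → M) :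
    ∑ σ, f σ = f 1 + f (conj ℚ k) := by
  classical
  have hG : Nat.card (k ≃ₐ[ℚ] k) = 2 := by
    rw [IsGalois.card_aut_eq_finrank, Algebra.IsQuadraticExtension.finrank_eq_two (R := ℚ) (S := k)]
  have huniv : (Finset.univ : Finset (k ≃ₐ[ℚ] k)) = {1, conj ℚ k} := by
    ext σ
    simp only [Finset.mem_univ, Finset.mem_insert, Finset.mem_singleton, true_iff]
    exact eq_one_or_eq_of_card_two hG (conj_ne_one ℚ k) σ
  rw [huniv, Finset.sum_pair (conj_ne_one ℚ k).symm]

/-- An element fixed by `σ` is rational (`2x = x + σx = Tr(x)`). [folklore] -/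
private theorem exists_rat_eq_of_conj_eq {x : k} (hx : conj ℚ k x = x) : ∃ q : ℚ, algebraMap ℚ k q = x := by
  classical
  have htr := trace_eq_sum_automorphisms (K := ℚ) (L := k) x
  rw [sum_aut_eq k, AlgEquiv.one_apply, hx] at htr
  refine ⟨Algebra.trace ℚ k x / 2, ?_⟩
  rw [map_div₀, htr, map_ofNat]
  ring

/-- The determinant of a hermitian matrix is fixed by `σ` (`σ(det T) = det ᵗT = det T`). [folklore] -/
private theorem conj_det_eq {n : ℕ} {T : Matrix (Fin n) (Fin n) k} (hT : IsHermitianFor (conj ℚ k : k →+* k) T) :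
    conj ℚ k T.det = T.det := by
  have h := (conj ℚ k : k →+* k).map_det T
  have hmap : (conj ℚ k : k →+* k).mapMatrix T = T.transpose := by
    ext i j
    exact hT i j
  rw [hmap, Matrix.det_transpose] at h
  exact h

/-! ### A split prime has two primes above it, and `d_k` is a `p`-adic square there -/

omit [IsTotallyComplex k] in
/-- If `p ∤ d_k` and `p O_k` is not a prime ideal then two primes of `O_k` lie over `p` (`e f g = 2` with `e = 1`
by Mathlib's `not_dvd_discr_iff_forall_liesOver`, and `g = 1` would make `p O_k` prime). [folklore] -/
private theorem ncard_primesOver_eq_two {p : ℕ} (hp : p.Prime) (hdisc : ¬ (p : ℤ) ∣ NumberField.discr k)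
    (hnp : ¬ (Ideal.span {(p : 𝓞 k)}).IsPrime) : ((Ideal.span {(p : ℤ)}).primesOver (𝓞 k)).ncard = 2 := by
  classical
  haveI : IsGaloisGroup (k ≃ₐ[ℚ] k) ℤ (𝓞 k) := IsGaloisGroup.of_isFractionRing (k ≃ₐ[ℚ] k) ℤ (𝓞 k) ℚ k
  have hG : Nat.card (k ≃ₐ[ℚ] k) = 2 := by
    rw [IsGalois.card_aut_eq_finrank, Algebra.IsQuadraticExtension.finrank_eq_two (R := ℚ) (S := k)]
  set P0 : Ideal ℤ := Ideal.span {(p : ℤ)} with hP0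
  have hpZ : Prime (p : ℤ) := Nat.prime_iff_prime_int.mp hp
  have hP0ne : P0 ≠ ⊥ := by
    rw [hP0, Ne, Ideal.span_singleton_eq_bot]
    exact hpZ.ne_zero
  haveI : P0.IsMaximal := ((Ideal.span_singleton_prime hpZ.ne_zero).mpr hpZ).isMaximal hP0ne
  have hefg := Ideal.ncard_primesOver_mul_ramificationIdxIn_mul_inertiaDegIn P0 (𝓞 k) (k ≃ₐ[ℚ] k)
  rw [hG] at hefg
  -- `e = 1`
  have hne0 : (P0.primesOver (𝓞 k)).ncard ≠ 0 := IsDedekindDomain.primesOver_ncard_ne_zero P0 (𝓞 k)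
  obtain ⟨Q, hQ⟩ := Set.nonempty_of_ncard_ne_zero hne0
  haveI := hQ.1
  haveI := hQ.2
  have hQne : Q ≠ ⊥ := Ideal.ne_bot_of_liesOver_of_ne_bot hP0ne Q
  haveI hQmax : Q.IsMaximal := hQ.1.isMaximal hQne
  haveI : Algebra.IsUnramifiedAt ℤ Q :=
    (NumberField.not_dvd_discr_iff_forall_liesOver k (𝓞 k) hpZ).mp hdisc Q hQmax hQ.2
  have he1 : P0.ramificationIdxIn (𝓞 k) = 1 := by
    rw [Ideal.ramificationIdxIn_eq_ramificationIdx P0 Q (k ≃ₐ[ℚ] k)]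
    exact Ideal.ramificationIdx_eq_one_of_isUnramifiedAt
  rw [he1, one_mul] at hefg
  by_contra hne
  have hncard : (P0.primesOver (𝓞 k)).ncard = 1 := by
    have hdvd : (P0.primesOver (𝓞 k)).ncard ∣ 2 := Dvd.intro _ hefg
    rcases (Nat.dvd_prime Nat.prime_two).mp hdvd with h | h
    · exact h
    · exact absurd h hne
  obtain ⟨Q', hset⟩ := Set.ncard_eq_one.mp hncard
  have hQ' : Q = Q' := by
    have : Q ∈ ({Q'} : Set (Ideal (𝓞 k))) := hset ▸ hQ
    simpa using this
  subst hQ'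
  have hfac := Ideal.map_algebraMap_eq_finsetProd_pow (R := 𝓞 k) hP0ne
  have heQ : Q.ramificationIdx ℤ = 1 := by
    rw [← Ideal.ramificationIdxIn_eq_ramificationIdx P0 Q (k ≃ₐ[ℚ] k), he1]
  simp only [hset, Set.toFinset_singleton, Finset.prod_singleton, heQ, pow_one] at hfac
  have hmap : P0.map (algebraMap ℤ (𝓞 k)) = Ideal.span {(p : 𝓞 k)} := by
    rw [hP0, Ideal.map_span, Set.image_singleton, map_natCast]
  rw [hmap] at hfac
  exact hnp (hfac ▸ hQ.1)

omit [IsTotallyComplex k] in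
/-- If `p ∤ d_k` and two primes lie over `p`, then `d_k` is a square in `ℤ_p`: `d_k ≡ β² (mod 4p)` (tree ★
`exists_dvd_sq_sub_discr_of_ncard_primesOver`) and Hensel's lemma for `X² − d_k` at `β`. [folklore] -/
private theorem exists_padicInt_sq_eq {p : ℕ} [hpF : Fact p.Prime] (hdisc : ¬ (p : ℤ) ∣ NumberField.discr k)
    (hsplit : ((Ideal.span {(p : ℤ)}).primesOver (𝓞 k)).ncard = 2) :
    ∃ z : ℤ_[p], z * z = (NumberField.discr k : ℤ_[p]) := by
  have hp := hpF.out
  have h2 : finrank ℚ k = 2 := Algebra.IsQuadraticExtension.finrank_eq_two (R := ℚ) (S := k)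
  obtain ⟨β, hβ⟩ := exists_dvd_sq_sub_discr_of_ncard_primesOver (K := k) h2 (N := p) hp.ne_zero
    (fun q hq hqp => by rwa [(Nat.prime_dvd_prime_iff_eq hq hp).mp hqp])
  set Δ : ℤ := NumberField.discr k with hΔ
  -- `β` is a `p`-adic unit
  have hβunit : ‖(β : ℤ_[p])‖ = 1 := by
    refine le_antisymm (PadicInt.norm_le_one _) (not_lt.mp fun hlt => hdisc ?_)
    have hpβ : (p : ℤ) ∣ β := (PadicInt.norm_int_lt_one_iff_dvd β).mp hlt
    have h4p : (p : ℤ) ∣ β ^ 2 - Δ := (Dvd.intro_left _ rfl : (p : ℤ) ∣ 4 * p).trans hβ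
    have hsq : (p : ℤ) ∣ β ^ 2 := Dvd.dvd.pow hpβ two_ne_zero
    have h := dvd_sub hsq h4p
    rwa [sub_sub_cancel] at h
  -- Hensel for `F = X² − Δ` at `β`
  set F : ℤ[X] := X ^ 2 - C Δ with hF
  have hFa : ∀ a : ℤ_[p], F.aeval a = a ^ 2 - (Δ : ℤ_[p]) := fun a => by
    simp [hF, map_intCast]
  have hF'a : ∀ a : ℤ_[p], F.derivative.aeval a = 2 * a := fun a => by
    rw [hF, derivative_sub, derivative_C, sub_zero, derivative_X_pow, map_mul, aeval_C, aeval_X_pow]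
    simp
  have hnorm : ‖F.aeval (β : ℤ_[p])‖ < ‖F.derivative.aeval (β : ℤ_[p])‖ ^ 2 := by
    rw [hFa, hF'a, norm_mul, hβunit, mul_one]
    have hcast : ((β : ℤ_[p]) ^ 2 - (Δ : ℤ_[p])) = ((β ^ 2 - Δ : ℤ) : ℤ_[p]) := by push_cast; ring
    obtain ⟨c, hc⟩ := hβ
    rw [hcast, hc]
    push_cast
    have h4 : ‖(4 : ℤ_[p])‖ = ‖(2 : ℤ_[p])‖ ^ 2 := by
      rw [show (4 : ℤ_[p]) = 2 ^ 2 by norm_num, norm_pow]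
    rw [norm_mul, norm_mul, PadicInt.norm_p, h4]
    have h2pos : 0 < ‖(2 : ℤ_[p])‖ ^ 2 := pow_pos (norm_pos_iff.mpr two_ne_zero) 2
    have hpinv : (p : ℝ)⁻¹ < 1 := inv_lt_one_of_one_lt₀ (by exact_mod_cast hp.one_lt)
    have hc1 : ‖(c : ℤ_[p])‖ ≤ 1 := PadicInt.norm_le_one _
    calc ‖(2 : ℤ_[p])‖ ^ 2 * (p : ℝ)⁻¹ * ‖(c : ℤ_[p])‖ ≤ ‖(2 : ℤ_[p])‖ ^ 2 * (p : ℝ)⁻¹ :=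
          mul_le_of_le_one_right (by positivity) hc1
      _ < ‖(2 : ℤ_[p])‖ ^ 2 := mul_lt_of_lt_one_right h2pos hpinv
  obtain ⟨z, hz, -⟩ := hensels_lemma hnorm
  refine ⟨z, ?_⟩
  rw [hFa, sub_eq_zero] at hz
  rw [← sq, hz]

/-! ### Local norms at a split prime -/

/-- With `θ² = Δ`, `σ(θ) = −θ` in `k` and `δ² = Δ`, `δ ≠ 0` in `ℚ_p`, every rational `a` is a local norm at `p`:
`z = (a+1)/2 ⊗ 1 + (a−1)/(2δ) ⊗ θ` has `z σ̃(z) = ((a+1)/2)² − Δ((a−1)/(2δ))² = a`. [folklore] -/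
private theorem isLocalNormAt_of_sq_eq {p : ℕ} [Fact p.Prime] {θ : k} {Δ : ℚ} (hθ : θ * θ = algebraMap ℚ k Δ)
    (hσθ : conj ℚ k θ = -θ) {δ : ℚ_[p]} (hδ : δ * δ = algebraMap ℚ ℚ_[p] Δ) (hδ0 : δ ≠ 0) (a : ℚ) :
    IsLocalNormAt k p a := by
  set α : ℚ_[p] := algebraMap ℚ ℚ_[p] a with hα
  set x : ℚ_[p] := (α + 1) / 2 with hx
  set y : ℚ_[p] := (α - 1) / (2 * δ) with hy
  refine ⟨x ⊗ₜ[ℚ] (1 : k) + y ⊗ₜ[ℚ] θ, ?_⟩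
  set σA := Algebra.TensorProduct.map (AlgHom.id ℚ ℚ_[p]) (conj ℚ k : k →ₐ[ℚ] k) with hσA
  have hc1 : (conj ℚ k : k →ₐ[ℚ] k) 1 = 1 := map_one _
  have hcθ : (conj ℚ k : k →ₐ[ℚ] k) θ = -θ := hσθ
  have hσ1 : σA (x ⊗ₜ[ℚ] (1 : k)) = x ⊗ₜ[ℚ] (1 : k) := by
    rw [hσA, Algebra.TensorProduct.map_tmul, AlgHom.id_apply, hc1]
  have hσ2 : σA (y ⊗ₜ[ℚ] θ) = -(y ⊗ₜ[ℚ] θ) := by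
    rw [hσA, Algebra.TensorProduct.map_tmul, AlgHom.id_apply, hcθ, TensorProduct.tmul_neg]
  rw [map_add, hσ1, hσ2]
  have hxy : x * x - Δ • (y * y) = α := by
    rw [Algebra.smul_def, ← hδ, hx, hy]
    field_simp
    ring
  have hΔk : algebraMap ℚ k Δ = Δ • (1 : k) := Algebra.algebraMap_eq_smul_one Δ
  calc (x ⊗ₜ[ℚ] (1 : k) + y ⊗ₜ[ℚ] θ) * (x ⊗ₜ[ℚ] (1 : k) + -(y ⊗ₜ[ℚ] θ))
      = x ⊗ₜ[ℚ] (1 : k) * (x ⊗ₜ[ℚ] (1 : k)) - y ⊗ₜ[ℚ] θ * (y ⊗ₜ[ℚ] θ) := by ring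
    _ = (x * x) ⊗ₜ[ℚ] (1 : k) - (y * y) ⊗ₜ[ℚ] (θ * θ) := by
        rw [Algebra.TensorProduct.tmul_mul_tmul, Algebra.TensorProduct.tmul_mul_tmul, mul_one]
    _ = (x * x) ⊗ₜ[ℚ] (1 : k) - (Δ • (y * y)) ⊗ₜ[ℚ] (1 : k) := by
        rw [hθ, hΔk, TensorProduct.tmul_smul, TensorProduct.smul_tmul']
    _ = α ⊗ₜ[ℚ] (1 : k) := by rw [← TensorProduct.sub_tmul, hxy]

/-- At a prime `p ∤ d_k` with `p O_k` not prime (a split prime) every rational number is a local norm from `k_p = ℚ_p × ℚ_p`.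
[cite: KudlaRapoport2013, §9 (9.2) (arXiv v2 p. 33)] -/
private theorem isLocalNormAt_of_split {p : ℕ} [Fact p.Prime] (hdisc : ¬ (p : ℤ) ∣ NumberField.discr k)
    (hnp : ¬ (Ideal.span {(p : 𝓞 k)}).IsPrime) (a : ℚ) : IsLocalNormAt k p a := by
  have hp : p.Prime := Fact.out
  have h2 : finrank ℚ k = 2 := Algebra.IsQuadraticExtension.finrank_eq_two (R := ℚ) (S := k)
  obtain ⟨z, hz⟩ := exists_padicInt_sq_eq k hdisc (ncard_primesOver_eq_two k hp hdisc hnp)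
  -- `θ = 2ω − t`, `θ² = d_k`, `σ(θ) = −θ`
  obtain ⟨b, hb⟩ := exists_basis_zero_eq_one (K := k) h2
  set ω : 𝓞 k := b 1 with hω
  set m : ℤ := b.repr (ω * ω) 0 with hm
  set t : ℤ := b.repr (ω * ω) 1 with ht
  have hωω : (ω : k) * ω = (m : k) + (t : k) * ω := by
    have h := congrArg (fun w : 𝓞 k => (w : k)) (basis_one_mul_self_eq b hb)
    simpa using h
  have hΔ : NumberField.discr k = t ^ 2 + 4 * m := discr_eq_sq_add_four_mul b hb
  -- `σ(ω) = t − ω` (else `σ = 1` on `k = ℚ ⊕ ℚ ω`)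
  have hσω : conj ℚ k (ω : k) = (t : k) - ω := by
    set s := conj ℚ k (ω : k) with hs
    have hss : s * s = (m : k) + (t : k) * s := by
      have h := congrArg (conj ℚ k) hωω
      simpa [map_mul, map_add, map_intCast] using h
    have hprod : (s - ω) * (s - ((t : k) - ω)) = 0 := by linear_combination hss - hωω
    rcases mul_eq_zero.mp hprod with h | h
    · exfalso
      apply conj_ne_one ℚ k
      have hsω : conj ℚ k (ω : k) = ω := sub_eq_zero.mp h
      let B : Basis (Fin 2) ℚ k := b.localizationLocalization ℚ (nonZeroDivisors ℤ) k
      have hB0 : B 0 = 1 := by simp [B, hb]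
      have hB1 : B 1 = (ω : k) := by simp [B, hω]
      refine AlgEquiv.ext fun u => ?_
      have hu := B.sum_repr u
      rw [Fin.sum_univ_two, hB0, hB1, Rat.smul_one_eq_cast, Rat.smul_def] at hu
      rw [← hu, map_add, map_mul, map_ratCast, map_ratCast, hsω, AlgEquiv.one_apply]
    · exact sub_eq_zero.mp h
  set θ : k := 2 * (ω : k) - t with hθdef
  have hθ : θ * θ = algebraMap ℚ k (NumberField.discr k : ℚ) := by
    rw [map_intCast, hΔ, hθdef]
    push_cast
    linear_combination (4 : k) * hωω
  have hσθ : conj ℚ k θ = -θ := by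
    rw [hθdef, map_sub, map_mul, map_ofNat, map_intCast, hσω]
    ring
  -- `δ = z ∈ ℚ_p`, `δ² = d_k ≠ 0`
  have hδ : (z : ℚ_[p]) * z = algebraMap ℚ ℚ_[p] (NumberField.discr k : ℚ) := by
    rw [← PadicInt.coe_mul, hz, PadicInt.coe_intCast, map_intCast]
  have hδ0 : (z : ℚ_[p]) ≠ 0 := by
    intro h0
    rw [h0, zero_mul, map_intCast] at hδ
    exact NumberField.discr_ne_zero k (by exact_mod_cast hδ.symm)
  exact isLocalNormAt_of_sq_eq k hθ hσθ hδ hδ0 a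

/-- ★ `KR2013_9_diff_subset` HOLDS. [KudlaRapoport2013, §9, after (9.2) (arXiv v2 p. 33)]: «Note that only ramified or inert primes
can occur in this set» — a prime of `Diff(T, V)` is not split: at a split `p` (`p ∤ d_k`, `p O_k` not prime) the discriminant is a
`p`-adic square (two primes over `p` by `e f g = 2`, `d_k ≡ β² (mod 4p)`, Hensel), so `k ⊗ ℚ_p ∋ (a+1)/2 ⊗ 1 + (a−1)/(2√d_k) ⊗ √d_k` has
norm `a` for every rational `a`, and the rational numbers `det T`, `det J` (hermitian) are both local norms.
[cite: KudlaRapoport2013, §9 (9.2) (arXiv v2 p. 33)] -/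
theorem KR2013_9_diff_subset_holds : KR2013_9_diff_subset k := by
  intro n T J hT hJ _ _ p hp
  obtain ⟨hpF, hdiff⟩ := hp
  have hpp : p.Prime := hpF.out
  obtain ⟨dT, hdT⟩ := exists_rat_eq_of_conj_eq k (conj_det_eq k hT)
  obtain ⟨dJ, hdJ⟩ := exists_rat_eq_of_conj_eq k (conj_det_eq k hJ)
  have hnd := hdiff dT dJ hdT hdJ
  by_cases hram : p ∣ (NumberField.discr k).natAbs
  · exact Or.inl ⟨hpp, hram⟩
  · refine Or.inr ⟨hpp, hram, ?_⟩
    by_contra hnp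
    have hdisc : ¬ (p : ℤ) ∣ NumberField.discr k := by rwa [Int.natCast_dvd]
    exact hnd ⟨fun _ => isLocalNormAt_of_split k hdisc hnp dJ, fun _ => isLocalNormAt_of_split k hdisc hnp dT⟩

end Literature.AlgebraicGeometry.ShimuraVarieties.KudlaRapoport2013.Sec7to10EisensteinSide
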